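/-
Origin: expansion seat `planner-pub-hodgecm-toy2-g5-0`, handover #13 2026-08-18T09:52:32Z (`HOME/pub-hodgecm-toy2-g5/lean/Toy2g5/ToyDimBump.lean`, md5 587344b3, 467 lines);
landed by the gen-7 packager in gate run 28 as `HodgeCM/Model/Toy/ToyDimBump.lean` (stripped 5 #print/#check/#eval lines).
-/
/-
Copyright: pub-hodgecm formalisation cell (harness21, 2026). New file (not vendored).
Origin: HOME/pub-hodgecm-toy2-g5/lean/Toy2g5/ToyDimBump.lean — session planner-pub-hodgecm-toy2-g5-0 (unit pub-hodgecm-toy2-g5,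
CONSISTENCY seat 2, part (6a)(ii), generation 5).  WIP module `Toy2g5.ToyDimBump`; intended final place
`HodgeCM/Model/Toy/ToyDimBump.lean` (module `HodgeCM.Model.Toy.ToyDimBump`).  NO import to rewrite on landing (v2/v3: rebased on
the RUN-27 tree copy `HodgeCM.Model.Toy.ToyPadH0FundDescent` of my #10; v1 imported the WIP module `Toy2g5.ToyPadH0FundDescent`;
v3 adds F2 = M35, M38, M42 and `HC_CM` to the context; v4 adds the same maximal context for the F5 separation of
`HodgeCM.Model.Toy.ToyCupScale` (run 27), imported by its tree name).
-/
import Summits.HodgeConjecture.HodgeCM.Model.Toy.ToyPadH0FundDescent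
import Summits.HodgeConjecture.HodgeCM.Model.Toy.ToyTrTop
import Summits.HodgeConjecture.HodgeCM.Model.Toy.ToyF2
import Summits.HodgeConjecture.HodgeCM.Model.Toy.CMInflation
import Summits.HodgeConjecture.HodgeCM.Model.Toy.ToyCupScale

/-!
# M40 `Fact_dimProd` is independent: re-dimensioning one product

`dim` enters the axiom list only through M6 (`tr_degree`), M11 (`cmAV`), M17 (`PmsDimTwo`), M26 (`gysin_surface`),
M28 (`algDuality`) and, among the open inputs, through F7 / F7d / F7d-B (the fibre dimension of a block of CM products)
and M40 itself.  None of them evaluates `dim` at a product of two ATOMLESS objects such as `pms × pms`.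

* `U.withDim d := {U with dim := d}` — generic re-dimensioning; `WithDim.modelAxioms` (the 23 `dim`-free fields transfer,
  the five `dim`-fields are hypotheses), `Iff.rfl` transfer of every `dim`-free input, and transfer of F7 / F7d / F7d-B
  as soon as `d` agrees with `dim` on CM products (`GysinAt`, `GysinDescentAt`, `GysinDescentBAt`: the three statements
  with the fibre dimension as a parameter);
* `dimBump X := dim X + [shape X = empty ⊔ empty]` on the exterior model and **`bumpModel := toyModel.withDim dimBump`**:
  every axiom and every open input of the descent profile holds (`tr = 0` makes M6/M26 trivial; CM objects, their
  products, `prod4` and `pms` keep their dimension definitionally), but `dim (pms × pms) = 5 ≠ 2 + 2`.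

Headline `HodgeCM.Toy.fact_dimProd_independent`: M40 is independent of
`DimContext := ModelAxioms ∧ N1 ∧ N2 ∧ N3 ∧ N4 ∧ F2 ∧ F4 ∧ F5 ∧ F7 ∧ F7d ∧ F7d-B ∧ Fact_unitH0 ∧ N5 ∧ Fact_cmInflation ∧
Fact_H0_rank ∧ W_RK4 ∧ PohlmannSpan ∧ Qw8MilnePos ∧ CMProdH0Nontrivial ∧ HC_CM` — i.e. of M1–M28, M32–M35, M37, M38, M41–M43,
N5, F7, F7d-B, the Pohlmann/QW8-side inputs AND the conclusion `HC_CM`: every named input of FACTS §1c that the exterior model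
satisfies (it refutes F6, T, T-CM) — with `toyModel`: M40 true, `bumpModel`: M40 false.
FACTS §1c P5 row (D) = M40 ('none filed').  Addendum (§ at the end): the F5 separation `cupModel` of
`HodgeCM.Model.Toy.ToyCupScale` in the same maximal context (`CupContextMax`, `fact_cupAssoc_independent_max`; row F5).
Nothing is cited; Lean + Mathlib axioms only.
-/

noncomputable section

namespace HodgeCM

open Literature.AlgebraicGeometry.Motives (CMType HodgeStructure)

namespace Universe

variable {U : Universe}

/-! ### F7, F7d, F7d-B with the fibre dimension as a parameter -/

/-- the body of F7 `Fact_gysin` for one block pair, with `dim Y'` replaced by a parameter `D` -/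
def GysinAt (U : Universe) (F : CMField) (n m : ℕ) (Ξ : Fin (n + 1 + (m + 1)) → CMType F)
    (pA : U.Mor (U.cmProd F Ξ) (U.cmProd F (blkA Ξ))) (pB : U.Mor (U.cmProd F Ξ) (U.cmProd F (blkB Ξ))) (D : ℕ) : Prop :=
  ∃ gy : (k : ℕ) → (U.Coh (U.cmProd F Ξ) (k + 2 * D) →ₗ[ℚ] U.Coh (U.cmProd F (blkA Ξ)) k),
    (∀ (p : ℕ) (z : U.Coh (U.cmProd F Ξ) (2 * (p + D))),
        z ∈ U.alg (U.cmProd F Ξ) (p + D) → gy (2 * p) (U.castCoh _ (by omega) z) ∈ U.alg (U.cmProd F (blkA Ξ)) p) ∧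
    (∀ (k : ℕ) (e : U.Coh (U.cmProd F (blkA Ξ)) k) (ω : U.Coh (U.cmProd F (blkB Ξ)) (2 * D)),
        gy k (U.cup (U.cmProd F Ξ) k _ (U.pull pA k e) (U.pull pB _ ω)) = (U.tr _ _ ω) • e)

/-- the body of F7d `Fact_gysinDescent` for one block pair, with `dim Y'` replaced by a parameter `D` -/
def GysinDescentAt (U : Universe) (F : CMField) (n m : ℕ) (Ξ : Fin (n + 1 + (m + 1)) → CMType F)
    (pA : U.Mor (U.cmProd F Ξ) (U.cmProd F (blkA Ξ))) (pB : U.Mor (U.cmProd F Ξ) (U.cmProd F (blkB Ξ))) (D : ℕ) : Prop :=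
  ∀ ω : U.Coh (U.cmProd F (blkB Ξ)) (2 * D), ω ≠ 0 →
    (∀ (k : ℕ) (e : U.Coh (U.cmProd F (blkA Ξ)) k),
        U.cup (U.cmProd F Ξ) k _ (U.pull pA k e) (U.pull pB _ ω) = 0 → e = 0) ∧
    (∀ (p : ℕ) (e : U.Coh (U.cmProd F (blkA Ξ)) (2 * p)),
        U.castCoh (U.cmProd F Ξ) (by omega : 2 * p + 2 * D = 2 * (p + D))
            (U.cup (U.cmProd F Ξ) (2 * p) _ (U.pull pA (2 * p) e) (U.pull pB _ ω)) ∈ U.alg (U.cmProd F Ξ) (p + D) →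
        e ∈ U.alg (U.cmProd F (blkA Ξ)) p)

/-- the body of F7d-B `Fact_gysinDescentB` for one block pair, with `dim Y'` replaced by a parameter `D` -/
def GysinDescentBAt (U : Universe) (F : CMField) (n m : ℕ) (Ξ : Fin (n + 1 + (m + 1)) → CMType F)
    (pA : U.Mor (U.cmProd F Ξ) (U.cmProd F (blkA Ξ))) (pB : U.Mor (U.cmProd F Ξ) (U.cmProd F (blkB Ξ))) (D : ℕ) : Prop :=
  ∀ ω : U.Coh (U.cmProd F (blkB Ξ)) (2 * D), ω ≠ 0 →
    ∀ (p : ℕ) (e : U.Coh (U.cmProd F (blkA Ξ)) (2 * p)),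
      U.castCoh (U.cmProd F Ξ) (by omega : 2 * p + 2 * D = 2 * (p + D))
          (U.cup (U.cmProd F Ξ) (2 * p) _ (U.pull pA (2 * p) e) (U.pull pB _ ω)) ∈ U.alg (U.cmProd F Ξ) (p + D) →
      e ∈ U.alg (U.cmProd F (blkA Ξ)) p

/-- (Ported verbatim from the HodgeCMPerL package; no docstring in the source.) -/
theorem fact_gysin_iff_gysinAt : U.Fact_gysin ↔ ∀ (F : CMField) (n m : ℕ) (Ξ : Fin (n + 1 + (m + 1)) → CMType F)
    (pA : U.Mor (U.cmProd F Ξ) (U.cmProd F (blkA Ξ))) (pB : U.Mor (U.cmProd F Ξ) (U.cmProd F (blkB Ξ))),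
    U.IsBlockPair F Ξ pA pB → U.GysinAt F n m Ξ pA pB (U.dim (U.cmProd F (blkB Ξ))) := Iff.rfl

/-- (Ported verbatim from the HodgeCMPerL package; no docstring in the source.) -/
theorem fact_gysinDescent_iff_at : U.Fact_gysinDescent ↔ ∀ (F : CMField) (n m : ℕ) (Ξ : Fin (n + 1 + (m + 1)) → CMType F)
    (pA : U.Mor (U.cmProd F Ξ) (U.cmProd F (blkA Ξ))) (pB : U.Mor (U.cmProd F Ξ) (U.cmProd F (blkB Ξ))),
    U.IsBlockPair F Ξ pA pB → U.GysinDescentAt F n m Ξ pA pB (U.dim (U.cmProd F (blkB Ξ))) := Iff.rfl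

/-- (Ported verbatim from the HodgeCMPerL package; no docstring in the source.) -/
theorem fact_gysinDescentB_iff_at : U.Fact_gysinDescentB ↔ ∀ (F : CMField) (n m : ℕ) (Ξ : Fin (n + 1 + (m + 1)) → CMType F)
    (pA : U.Mor (U.cmProd F Ξ) (U.cmProd F (blkA Ξ))) (pB : U.Mor (U.cmProd F Ξ) (U.cmProd F (blkB Ξ))),
    U.IsBlockPair F Ξ pA pB → U.GysinDescentBAt F n m Ξ pA pB (U.dim (U.cmProd F (blkB Ξ))) := Iff.rfl

/-- the body of M28 `Fact_algDuality` for one `prod4`, with `dim P` replaced by a parameter `D` -/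
def AlgDualityAt (U : Universe) (K : CMField) (Φ : Fin 4 → CMType K) (D : ℕ) : Prop :=
  ∃ Dm : U.Coh (U.prod4 K Φ) (2 * (D - 2)) →ₗ[ℚ] U.Coh (U.prod4 K Φ) 4,
    Function.Bijective Dm ∧
    (U.alg (U.prod4 K Φ) (D - 2)).map Dm ≤ U.alg (U.prod4 K Φ) 2 ∧
    ∀ (a : K) (Ma Mb : U.Mor (U.prod4 K Φ) (U.prod4 K Φ)),
      U.IsDiagAct K Φ a Ma → U.IsDiagAct K Φ (Literature.AlgebraicGeometry.ShimuraVarieties.conjRingHomK K a) Mb →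
        U.pull Mb 4 ∘ₗ Dm ∘ₗ U.pull Ma (2 * (D - 2)) = ((Algebra.norm ℚ a) ^ 4) • Dm

/-- (Ported verbatim from the HodgeCMPerL package; no docstring in the source.) -/
theorem fact_algDuality_iff_at :
    U.Fact_algDuality ↔ ∀ (K : CMField) (Φ : Fin 4 → CMType K), U.AlgDualityAt K Φ (U.dim (U.prod4 K Φ)) := Iff.rfl

/-! ### Re-dimensioning a universe -/

/-- **Re-dimensioning**: the same universe with another dimension function. -/
abbrev withDim (U : Universe) (d : U.Var → ℕ) : Universe := { U with dim := d }

namespace WithDim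

variable {d : U.Var → ℕ}

/-- (Ported verbatim from the HodgeCMPerL package; no docstring in the source.) -/
theorem dim_eq (X : U.Var) : (U.withDim d).dim X = d X := rfl

set_option smartUnfolding false in
/-- **`ModelAxioms` transfer to `U.withDim d`**: the 23 `dim`-free fields definitionally; M6, M11, M17, M26, M28 are the
hypotheses. -/
theorem modelAxioms (M : U.ModelAxioms) (h6 : (U.withDim d).Fact_tr_degree) (h11 : (U.withDim d).Fact_cmAV)
    (h17 : (U.withDim d).PmsDimTwo) (h26 : (U.withDim d).Fact_gysin_surface) (h28 : (U.withDim d).Fact_algDuality) :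
    (U.withDim d).ModelAxioms where
  pull_id := M.pull_id
  pull_comp := M.pull_comp
  pull_cup := M.pull_cup
  pull_hodge := M.pull_hodge
  cup2_hodge := M.cup2_hodge
  tr_degree := h6
  alg_le_hodge := M.alg_le_hodge
  pull_alg := M.pull_alg
  cup_alg := M.cup_alg
  lefschetz11 := M.lefschetz11
  cmAV := h11
  eigenLine := M.eigenLine
  alphaLine := M.alphaLine
  cmDominated := M.cmDominated
  weilLine_rank := M.weilLine_rank
  weilLine_hodge := M.weilLine_hodge
  pms_dim := h17
  lift := M.lift
  cup_comm1 := M.cup_comm1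
  cup_interchange := M.cup_interchange
  kunneth1 := M.kunneth1
  H1_rank := M.H1_rank
  H4_span := M.H4_span
  cmEnd := M.cmEnd
  conjIsogeny := M.conjIsogeny
  gysin_surface := h26
  deg_diag := M.deg_diag
  algDuality := h28

/-! ### The `dim`-free inputs transfer definitionally -/

set_option smartUnfolding false in
/-- (Ported verbatim from the HodgeCMPerL package; no docstring in the source.) -/
theorem fact_cupExterior_iff : (U.withDim d).Fact_cupExterior ↔ U.Fact_cupExterior := Iff.rfl
set_option smartUnfolding false in
/-- (Ported verbatim from the HodgeCMPerL package; no docstring in the source.) -/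
theorem fact_cup_hodge_iff : (U.withDim d).Fact_cup_hodge ↔ U.Fact_cup_hodge := Iff.rfl
set_option smartUnfolding false in
/-- (Ported verbatim from the HodgeCMPerL package; no docstring in the source.) -/
theorem fact_pull_H0_iff : (U.withDim d).Fact_pull_H0 ↔ U.Fact_pull_H0 := Iff.rfl
set_option smartUnfolding false in
/-- (Ported verbatim from the HodgeCMPerL package; no docstring in the source.) -/
theorem fact_hodge_F0_iff : (U.withDim d).Fact_hodge_F0 ↔ U.Fact_hodge_F0 := Iff.rfl
set_option smartUnfolding false in
/-- (Ported verbatim from the HodgeCMPerL package; no docstring in the source.) -/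
theorem fact_cupAlg_iff : (U.withDim d).Fact_cupAlg ↔ U.Fact_cupAlg := Iff.rfl
set_option smartUnfolding false in
/-- (Ported verbatim from the HodgeCMPerL package; no docstring in the source.) -/
theorem fact_cupAssoc_iff : (U.withDim d).Fact_cupAssoc ↔ U.Fact_cupAssoc := Iff.rfl
set_option smartUnfolding false in
/-- (Ported verbatim from the HodgeCMPerL package; no docstring in the source.) -/
theorem fact_unitH0_iff : (U.withDim d).Fact_unitH0 ↔ U.Fact_unitH0 := Iff.rfl
set_option smartUnfolding false in
/-- (Ported verbatim from the HodgeCMPerL package; no docstring in the source.) -/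
theorem fact_fundClass_iff : (U.withDim d).Fact_fundClass ↔ U.Fact_fundClass := Iff.rfl
set_option smartUnfolding false in
/-- (Ported verbatim from the HodgeCMPerL package; no docstring in the source.) -/
theorem w_RK4_iff : (U.withDim d).W_RK4 ↔ U.W_RK4 := Iff.rfl
set_option smartUnfolding false in
/-- (Ported verbatim from the HodgeCMPerL package; no docstring in the source.) -/
theorem pohlmannSpan_iff : (U.withDim d).PohlmannSpan ↔ U.PohlmannSpan := Iff.rfl
set_option smartUnfolding false in
/-- (Ported verbatim from the HodgeCMPerL package; no docstring in the source.) -/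
theorem cmProdH0Nontrivial_iff : (U.withDim d).CMProdH0Nontrivial ↔ U.CMProdH0Nontrivial := Iff.rfl
set_option smartUnfolding false in
/-- (Ported verbatim from the HodgeCMPerL package; no docstring in the source.) -/
theorem hc_cm_iff : (U.withDim d).HC_CM ↔ U.HC_CM := Iff.rfl
set_option smartUnfolding false in
/-- (Ported verbatim from the HodgeCMPerL package; no docstring in the source.) -/
theorem fact_factorActDescends_iff : (U.withDim d).Fact_factorActDescends ↔ U.Fact_factorActDescends := Iff.rfl
/-- (Ported verbatim from the HodgeCMPerL package; no docstring in the source.) -/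
theorem fact_cmInflation_iff : (U.withDim d).Fact_cmInflation ↔ U.Fact_cmInflation := Iff.rfl
/-- (Ported verbatim from the HodgeCMPerL package; no docstring in the source.) -/
theorem fact_H0_rank_iff : (U.withDim d).Fact_H0_rank ↔ U.Fact_H0_rank := Iff.rfl

set_option smartUnfolding false in
/-- Weight-vector records of `U.withDim d` and of `U` are the same data. -/
def wvecOf {F : CMField} (z : (U.withDim d).WVec F) : U.WVec F :=
  ⟨z.n, z.Θ, z.p, z.S, z.x, z.ne_zero, z.isWeightVector⟩

set_option smartUnfolding false in
/-- (Ported verbatim from the HodgeCMPerL package; no docstring in the source.) -/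
theorem qw8MilnePos (h : U.Qw8MilnePos) : (U.withDim d).Qw8MilnePos := fun F hG h6 z hp ha => h F hG h6 (wvecOf z) hp ha

/-! ### F7, F7d, F7d-B transfer when `d = dim` on CM products -/

section fibre

variable (hd : ∀ (F : CMField) (m : ℕ) (Θ : Fin (m + 1) → CMType F), d (U.cmProd F Θ) = U.dim (U.cmProd F Θ))
include hd

set_option smartUnfolding false in
/-- (Ported verbatim from the HodgeCMPerL package; no docstring in the source.) -/
theorem fact_gysin_iff : (U.withDim d).Fact_gysin ↔ U.Fact_gysin := by
  constructor
  · intro h F n m Ξ pA pB hP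
    have h1 : U.GysinAt F n m Ξ pA pB (d (U.cmProd F (blkB Ξ))) := h F n m Ξ pA pB hP
    rw [hd] at h1
    exact h1
  · intro h F n m Ξ pA pB hP
    have h1 : U.GysinAt F n m Ξ pA pB (U.dim (U.cmProd F (blkB Ξ))) := h F n m Ξ pA pB hP
    rw [← hd] at h1
    exact h1

set_option smartUnfolding false in
/-- (Ported verbatim from the HodgeCMPerL package; no docstring in the source.) -/
theorem fact_gysinDescent_iff : (U.withDim d).Fact_gysinDescent ↔ U.Fact_gysinDescent := by
  constructor
  · intro h F n m Ξ pA pB hP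
    have h1 : U.GysinDescentAt F n m Ξ pA pB (d (U.cmProd F (blkB Ξ))) := h F n m Ξ pA pB hP
    rw [hd] at h1
    exact h1
  · intro h F n m Ξ pA pB hP
    have h1 : U.GysinDescentAt F n m Ξ pA pB (U.dim (U.cmProd F (blkB Ξ))) := h F n m Ξ pA pB hP
    rw [← hd] at h1
    exact h1

set_option smartUnfolding false in
/-- (Ported verbatim from the HodgeCMPerL package; no docstring in the source.) -/
theorem fact_gysinDescentB_iff : (U.withDim d).Fact_gysinDescentB ↔ U.Fact_gysinDescentB := by
  constructor
  · intro h F n m Ξ pA pB hP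
    have h1 : U.GysinDescentBAt F n m Ξ pA pB (d (U.cmProd F (blkB Ξ))) := h F n m Ξ pA pB hP
    rw [hd] at h1
    exact h1
  · intro h F n m Ξ pA pB hP
    have h1 : U.GysinDescentBAt F n m Ξ pA pB (U.dim (U.cmProd F (blkB Ξ))) := h F n m Ξ pA pB hP
    rw [← hd] at h1
    exact h1

end fibre

/-- M28 transfers when `d = dim` on the fourfold products `prod4`. -/
theorem fact_algDuality_iff (h4 : ∀ (K : CMField) (Φ : Fin 4 → CMType K), d (U.prod4 K Φ) = U.dim (U.prod4 K Φ)) :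
    (U.withDim d).Fact_algDuality ↔ U.Fact_algDuality := by
  constructor
  · intro h K Φ
    have h1 : U.AlgDualityAt K Φ (d (U.prod4 K Φ)) := h K Φ
    rw [h4] at h1
    exact h1
  · intro h K Φ
    have h1 : U.AlgDualityAt K Φ (U.dim (U.prod4 K Φ)) := h K Φ
    rw [← h4] at h1
    exact h1

/-! ### M40 fails as soon as `d` is not additive on one product -/

/-- (Ported verbatim from the HodgeCMPerL package; no docstring in the source.) -/
theorem not_fact_dimProd (X Y : U.Var) (h : d (U.prod X Y) ≠ d X + d Y) : ¬ (U.withDim d).Fact_dimProd :=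
  fun hD => h (hD X Y)

end WithDim

end Universe

namespace Toy

open Universe

/-! ### The bumped dimension on the exterior model -/

/-- `1` on the shape `empty ⊔ empty` (a product of two atomless objects), `0` otherwise; the second summand is
inspected first, so that `X × A_{(K,Φ)}` (all CM products, `prod4`) evaluates to `0` whatever `X` is. -/
def bumpOf : Shape → ℕ
  | .sum s₁ s₂ =>
    match s₂, s₁ with
    | .empty, .empty => 1
    | _, _ => 0
  | _ => 0

/-- **the bumped dimension**: `dim X + bumpOf (shape X)`. -/
def dimBump (X : Obj) : ℕ := Module.finrank ℚ X.L / 2 + X.extra + bumpOf X.s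

/-- (Ported verbatim from the HodgeCMPerL package; no docstring in the source.) -/
theorem toyModel_dim (X : Obj) : toyModel.dim X = Module.finrank ℚ X.L / 2 + X.extra := rfl

/-- (Ported verbatim from the HodgeCMPerL package; no docstring in the source.) -/
theorem dimBump_eq (X : Obj) : dimBump X = toyModel.dim X + bumpOf X.s := rfl

/-- (Ported verbatim from the HodgeCMPerL package; no docstring in the source.) -/
theorem dimBump_cmObj (K : CMField) (Φ : CMType K) : dimBump (cmObj K Φ) = toyModel.dim (cmObj K Φ) := rfl

/-- (Ported verbatim from the HodgeCMPerL package; no docstring in the source.) -/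
theorem dimBump_prod_cmObj (X : Obj) (K : CMField) (Φ : CMType K) :
    dimBump (X.prod (cmObj K Φ)) = toyModel.dim (X.prod (cmObj K Φ)) := rfl

/-- (Ported verbatim from the HodgeCMPerL package; no docstring in the source.) -/
theorem dimBump_pmsObj : dimBump pmsObj = 2 := by
  change Module.finrank ℚ pmsObj.L / 2 + 2 + 0 = 2
  rw [finrank_L_pmsObj]

/-- (Ported verbatim from the HodgeCMPerL package; no docstring in the source.) -/
theorem dimBump_pms2 : dimBump (pmsObj.prod pmsObj) = 5 := by
  change Module.finrank ℚ (pmsObj.prod pmsObj).L / 2 + (2 + 2) + 1 = 5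
  rw [finrank_L_prod, finrank_L_pmsObj]

/-- `dimBump = dim` on every CM product. -/
theorem dimBump_cmProd (F : CMField) (m : ℕ) (Θ : Fin (m + 1) → CMType F) :
    dimBump (toyModel.cmProd F Θ) = toyModel.dim (toyModel.cmProd F Θ) := by
  cases m with
  | zero => rfl
  | succ k => rfl

/-! ### `bumpModel` -/

/-- **`bumpModel`**: the exterior model with `dim (X × Y)` raised by one when `X`, `Y` are atomless. -/
def bumpModel : Universe := toyModel.withDim dimBump

/-- (Ported verbatim from the HodgeCMPerL package; no docstring in the source.) -/
theorem bumpModel_def : bumpModel = toyModel.withDim dimBump := rfl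

/-- (Ported verbatim from the HodgeCMPerL package; no docstring in the source.) -/
theorem dim_bumpModel (X : Obj) : bumpModel.dim X = dimBump X := rfl

/-- M6 (`tr = 0`). -/
theorem bumpModel_fact_tr_degree : bumpModel.Fact_tr_degree := fun _ _ _ => rfl

/-- M11: CM objects keep their dimension (definitionally). -/
theorem bumpModel_fact_cmAV : bumpModel.Fact_cmAV := toyModel_modelAxioms.cmAV

/-- M17: Picard modular surfaces keep dimension `2` (definitionally). -/
theorem bumpModel_pmsDimTwo : bumpModel.PmsDimTwo := toyModel_modelAxioms.pms_dim

/-- M26 (`tr = 0`). -/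
theorem bumpModel_fact_gysin_surface : bumpModel.Fact_gysin_surface := fun _ _ _ _ =>
  ⟨0, Submodule.zero_mem _, fun _ => rfl⟩

/-- (Ported verbatim from the HodgeCMPerL package; no docstring in the source.) -/
theorem dimBump_prod4 (K : CMField) (Φ : Fin 4 → CMType K) :
    dimBump (toyModel.prod4 K Φ) = toyModel.dim (toyModel.prod4 K Φ) := dimBump_prod_cmObj _ K (Φ 3)

/-- M28: `prod4` keeps its dimension. -/
theorem bumpModel_fact_algDuality : bumpModel.Fact_algDuality :=
  (WithDim.fact_algDuality_iff dimBump_prod4).mpr toyModel_modelAxioms.algDuality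

/-- **all 28 `ModelAxioms` hold in `bumpModel`.** -/
theorem bumpModel_modelAxioms : bumpModel.ModelAxioms :=
  WithDim.modelAxioms toyModel_modelAxioms bumpModel_fact_tr_degree bumpModel_fact_cmAV bumpModel_pmsDimTwo
    bumpModel_fact_gysin_surface bumpModel_fact_algDuality

/-- (Ported verbatim from the HodgeCMPerL package; no docstring in the source.) -/
theorem bumpModel_fact_cupExterior : bumpModel.Fact_cupExterior := WithDim.fact_cupExterior_iff.mpr toyModel_fact_cupExterior
/-- (Ported verbatim from the HodgeCMPerL package; no docstring in the source.) -/
theorem bumpModel_fact_cup_hodge : bumpModel.Fact_cup_hodge := WithDim.fact_cup_hodge_iff.mpr toyModel_fact_cup_hodge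
/-- (Ported verbatim from the HodgeCMPerL package; no docstring in the source.) -/
theorem bumpModel_fact_pull_H0 : bumpModel.Fact_pull_H0 := WithDim.fact_pull_H0_iff.mpr toyModel_fact_pull_H0
/-- (Ported verbatim from the HodgeCMPerL package; no docstring in the source.) -/
theorem bumpModel_fact_hodge_F0 : bumpModel.Fact_hodge_F0 := WithDim.fact_hodge_F0_iff.mpr toyModel_fact_hodge_F0
/-- (Ported verbatim from the HodgeCMPerL package; no docstring in the source.) -/
theorem bumpModel_fact_cupAlg : bumpModel.Fact_cupAlg := WithDim.fact_cupAlg_iff.mpr fact_cupAlg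
/-- (Ported verbatim from the HodgeCMPerL package; no docstring in the source.) -/
theorem bumpModel_fact_cupAssoc : bumpModel.Fact_cupAssoc := WithDim.fact_cupAssoc_iff.mpr (fact_cupAssoc exteriorHodgeData)
/-- (Ported verbatim from the HodgeCMPerL package; no docstring in the source.) -/
theorem bumpModel_fact_gysin : bumpModel.Fact_gysin := (WithDim.fact_gysin_iff dimBump_cmProd).mpr toyModel_fact_gysin
/-- (Ported verbatim from the HodgeCMPerL package; no docstring in the source.) -/
theorem bumpModel_fact_gysinDescent : bumpModel.Fact_gysinDescent :=
  (WithDim.fact_gysinDescent_iff dimBump_cmProd).mpr toyModel_fact_gysinDescent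
/-- (Ported verbatim from the HodgeCMPerL package; no docstring in the source.) -/
theorem bumpModel_fact_gysinDescentB : bumpModel.Fact_gysinDescentB :=
  (WithDim.fact_gysinDescentB_iff dimBump_cmProd).mpr toyModel_fact_gysinDescentB
/-- (Ported verbatim from the HodgeCMPerL package; no docstring in the source.) -/
theorem bumpModel_fact_unitH0 : bumpModel.Fact_unitH0 := WithDim.fact_unitH0_iff.mpr toyModel_fact_unitH0

-- port_pkg: scope closed for this part
end Toy
end HodgeCM
end
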